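import Mathlib.RingTheory.AdjoinRoot
import Mathlib.NumberTheory.LegendreSymbol.Basic
import Mathlib.Algebra.CharP.Algebra
import Mathlib.Algebra.CharP.Lemmas
import Literature.Computability.Cryptography.HallgrenClassGroupModArithFP
import HarnessLib

/-!
# Cipolla's square root modulo a prime: correctness of the `qpow` kernel and the count of good trials

A companion of the modular-arithmetic kernels of `HallgrenClassGroupModArithFP.lean` (`ArithFP.qmul`,
`ArithFP.qpow`: powers in `(ℤ/p)[θ]/(θ² − ω)` on pairs of residues, already on codes as
`ArithFP.qpowModC`). Cipolla's algorithm (Crandall–Pomerance, Algorithm 2.3.8, case `p ≡ 1 (mod 8)`,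
and §2.3.2): to extract `√n (mod p)` for an odd prime `p` and a non-zero square `n`, pick `t` with
`ω = t² − n` a NON-residue and return the first coordinate of `(t + θ)^{(p+1)/2}` computed in
`𝔽_p[θ]/(θ² − ω) ≅ 𝔽_{p²}`.

* `Cipolla.φ θ (u, v) = u + v θ` interprets the pairs of `qmul`/`qpow` in any commutative ring of
  characteristic `p` with a chosen `θ`, `θ² = ω`; `φ_qmul`, `φ_qpow` (**the kernel computes powers**:
  `φ (qpow ω p x e) = (φ x)^e`, binary method over `ArithFP.bits`);
* in `R = AdjoinRoot (X² − C ω)` over `𝔽_p`: `root_sq`, the Frobenius `(t + θ)^p = t − θ` when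
  `ω^{(p−1)/2} = −1` (`add_root_pow_p`), hence `((t + θ)^{(p+1)/2})² = t² − ω` (`cipolla_sq`), the
  coefficient extraction `of a + of b θ = 0 → a = b = 0` (`of_add_of_mul_root_eq_zero`), and the main
  statement **`sq_qpow_fst_eq`**: if `ω = t² − n` is a non-residue and `n` a residue then
  `u² = n` in `𝔽_p` for `u = (qpow ω p (t, 1) ((p+1)/2)).1`;
* the count (**`card_filter_isSquare_sq_sub_le`**): for `n ≠ 0`, at most `(p+1)/2` residues `t` have
  `t² − n` a square (the hyperbola `t² − s² = n` has `p − 1` points, `card_hyperbola`), so at least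
  `(p−1)/2` trials `t` are good (`le_card_filter_not_isSquare`).

## References

* R. Crandall, C. Pomerance, *Prime Numbers: A Computational Perspective*, Springer, §2.3.2,
  Algorithm 2.3.8 and the remark on the expected number of random `t` [CrandallPomerance1999].
* M. Cipolla, *Un metodo per la risoluzione della congruenza di secondo grado*, Napoli Rend. 9 (1903).
-/

namespace Literature.Computability.Cryptography.Hallgren2005

namespace Cipolla

open Polynomial ArithFP _root_.Computability Literature.Computability.Complexity

/-! ### The pairs of `qmul`/`qpow` interpreted in a ring of characteristic `p` -/

section Interp

variable {R : Type*} [CommRing R] (θ : R) (ω p : ℕ)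

/-- `(u, v) ↦ u + v θ`. [folklore] -/
def φ (x : ℕ × ℕ) : R := (x.1 : R) + (x.2 : R) * θ

/-- Reducing the coordinates modulo the characteristic does not change the interpretation. [folklore] -/
theorem φ_mod [CharP R p] (x : ℕ × ℕ) : φ θ (x.1 % p, x.2 % p) = φ θ x := by
  unfold φ
  rw [CharP.natCast_eq_natCast' R p (Nat.mod_modEq x.1 p), CharP.natCast_eq_natCast' R p (Nat.mod_modEq x.2 p)]

/-- **`qmul` is multiplication in `R`** when `θ² = ω`. [cite: CrandallPomerance1999, §2.3.2] -/
theorem φ_qmul [CharP R p] (hθ : θ * θ = (ω : R)) (x y : ℕ × ℕ) :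
    φ θ (qmul ω p x y) = φ θ x * φ θ y := by
  have h : φ θ (qmul ω p x y) = φ θ (x.1 * y.1 + x.2 * y.2 * ω, x.1 * y.2 + x.2 * y.1) :=
    φ_mod θ p (x.1 * y.1 + x.2 * y.2 * ω, x.1 * y.2 + x.2 * y.1)
  rw [h]
  unfold φ
  push_cast
  linear_combination ((x.2 : R) * y.2) * hθ.symm

/-- The binary method in `R`: after the bits `l`, `acc · base^{value of l}`. [cite: CrandallPomerance1999, §2.1.2] -/
theorem φ_foldl_qpowStep [CharP R p] (hθ : θ * θ = (ω : R)) :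
    ∀ (l : List Bool) (acc base : ℕ × ℕ),
      φ θ (l.foldl (qpowStep ω p) (acc, base)).1 = φ θ acc * φ θ base ^ bitsToNat l
  | [], acc, base => by simp
  | b :: l, acc, base => by
    rw [List.foldl_cons, bitsToNat_cons,
      show qpowStep ω p (acc, base) b = (if b then qmul ω p acc base else acc, qmul ω p base base) from rfl,
      φ_foldl_qpowStep hθ l, φ_qmul θ ω p hθ base base, pow_add, pow_mul]
    cases b
    · simp [sq]
    · simp only [if_true, Bool.toNat_true, pow_one, φ_qmul θ ω p hθ acc base]
      ring

/-- **`qpow` computes powers in `R`**: `φ (qpow ω p x e) = (φ x)^e`. [cite: CrandallPomerance1999, §2.3.2] -/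
theorem φ_qpow [CharP R p] (hθ : θ * θ = (ω : R)) (x : ℕ × ℕ) (e : ℕ) :
    φ θ (qpow ω p x e) = φ θ x ^ e := by
  rw [qpow, φ_foldl_qpowStep θ ω p hθ, φ_mod θ p x, show bitsToNat (bits e) = e from bitsToNat_encodeNat e]
  have h1 : φ θ (1 % p, 0) = 1 := by
    have := φ_mod θ p (1, 0)
    rw [Nat.zero_mod] at this
    rw [this]; simp [φ]
  rw [h1, one_mul]

end Interp

/-! ### Cipolla's identity in `𝔽_p[θ]/(θ² − ω)` -/

section Field

variable {p : ℕ} [hp : Fact p.Prime]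

/-- The Cipolla ring `𝔽_p[θ]/(θ² − ω)`. [cite: CrandallPomerance1999, §2.3.2] -/
abbrev CR (ω : ZMod p) : Type := AdjoinRoot (X ^ 2 - C ω : (ZMod p)[X])

/-- `θ² = ω` in the Cipolla ring. [folklore] -/
theorem root_sq (ω : ZMod p) :
    AdjoinRoot.root (X ^ 2 - C ω) * AdjoinRoot.root (X ^ 2 - C ω) = AdjoinRoot.of (X ^ 2 - C ω) ω := by
  have h := AdjoinRoot.eval₂_root (X ^ 2 - C ω : (ZMod p)[X])
  rw [eval₂_sub, eval₂_X_pow, eval₂_C, sub_eq_zero] at h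
  rw [← sq, h]

/-- The Cipolla ring is non-trivial (the modulus has degree `2`). [folklore] -/
instance instNontrivialCR (ω : ZMod p) : Nontrivial (CR ω) :=
  AdjoinRoot.nontrivial _ (by rw [degree_X_pow_sub_C (by norm_num) ω]; decide)

/-- The Cipolla ring has characteristic `p`. [folklore] -/
instance instCharPCR (ω : ZMod p) : CharP (CR ω) p :=
  charP_of_injective_algebraMap (algebraMap (ZMod p) (CR ω)).injective p

/-- **The Frobenius swaps the sign of `θ`** when `ω` is a non-residue: `(t + θ)^p = t − θ`.
[cite: CrandallPomerance1999, §2.3.2] -/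
theorem add_root_pow_p (hp2 : p ≠ 2) {ω : ZMod p} (hω : ω ^ (p / 2) = -1) (t : ZMod p) :
    (AdjoinRoot.of (X ^ 2 - C ω) t + AdjoinRoot.root (X ^ 2 - C ω)) ^ p =
      AdjoinRoot.of (X ^ 2 - C ω) t - AdjoinRoot.root (X ^ 2 - C ω) := by
  set θ := AdjoinRoot.root (X ^ 2 - C ω : (ZMod p)[X])
  set ι := AdjoinRoot.of (X ^ 2 - C ω : (ZMod p)[X])
  have hodd : p = 2 * (p / 2) + 1 := (Nat.two_mul_div_two_add_one_of_odd (hp.out.eq_two_or_odd'.resolve_left hp2)).symm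
  have hθp : θ ^ p = -θ := by
    have e : θ ^ p = θ ^ (2 * (p / 2) + 1) := by rw [← hodd]
    rw [e, pow_succ θ (2 * (p / 2)), pow_mul θ 2 (p / 2), sq θ, root_sq, ← map_pow, hω, map_neg, map_one,
      neg_one_mul]
  rw [add_pow_char, ← map_pow, ZMod.pow_card, hθp]
  exact (sub_eq_add_neg _ _).symm

/-- **Cipolla's identity**: `((t + θ)^{(p+1)/2})² = t² − ω` when `ω^{(p−1)/2} = −1`.
[cite: CrandallPomerance1999, §2.3.2 (Algorithm 2.3.8)] -/
theorem cipolla_sq (hp2 : p ≠ 2) {ω : ZMod p} (hω : ω ^ (p / 2) = -1) (t : ZMod p) :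
    ((AdjoinRoot.of (X ^ 2 - C ω) t + AdjoinRoot.root (X ^ 2 - C ω)) ^ ((p + 1) / 2)) ^ 2 =
      AdjoinRoot.of (X ^ 2 - C ω) (t ^ 2 - ω) := by
  have hodd : p = 2 * (p / 2) + 1 := (Nat.two_mul_div_two_add_one_of_odd (hp.out.eq_two_or_odd'.resolve_left hp2)).symm
  have he : (p + 1) / 2 * 2 = p + 1 := by omega
  rw [← pow_mul, he, pow_add, pow_one, add_root_pow_p hp2 hω t, map_sub, map_pow, ← root_sq]
  ring

/-- **Coefficient extraction**: `1, θ` are linearly independent over `𝔽_p` (the modulus is monic of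
degree `2`). [folklore] -/
theorem of_add_of_mul_root_eq_zero {ω a b : ZMod p}
    (h : AdjoinRoot.of (X ^ 2 - C ω) a + AdjoinRoot.of (X ^ 2 - C ω) b * AdjoinRoot.root (X ^ 2 - C ω) = 0) :
    a = 0 ∧ b = 0 := by
  have hmk : AdjoinRoot.mk (X ^ 2 - C ω) (C b * X + C a) = 0 := by
    rw [map_add, map_mul, AdjoinRoot.mk_C, AdjoinRoot.mk_C, AdjoinRoot.mk_X, add_comm]
    exact h
  rw [AdjoinRoot.mk_eq_zero] at hmk
  have hdeg : (C b * X + C a).degree < (X ^ 2 - C ω : (ZMod p)[X]).degree := by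
    rw [degree_X_pow_sub_C (by norm_num) ω]
    exact (degree_linear_le).trans_lt (by exact_mod_cast Nat.one_lt_two)
  have h0 := eq_zero_of_dvd_of_degree_lt hmk hdeg
  have ha : a = 0 := by simpa using congrArg (fun q : (ZMod p)[X] => q.coeff 0) h0
  have hb : b = 0 := by simpa using congrArg (fun q : (ZMod p)[X] => q.coeff 1) h0
  exact ⟨ha, hb⟩

/-- `2 ≠ 0` in `𝔽_p` for odd `p`. [folklore] -/
private theorem two_ne_zero_of_ne_two (hp2 : p ≠ 2) : (2 : ZMod p) ≠ 0 := by
  intro h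
  have h' : ((2 : ℕ) : ZMod p) = 0 := by exact_mod_cast h
  rw [ZMod.natCast_eq_zero_iff] at h'
  have := (Nat.prime_dvd_prime_iff_eq hp.out Nat.prime_two).1 h'
  exact hp2 this

/-- **A square root in the Cipolla ring with coordinates `(u, v)` of a residue `n`, for a non-residue
`ω`, lies in the base field**: `u² = n`. [cite: CrandallPomerance1999, §2.3.2] -/
theorem sq_eq_of_coords (hp2 : p ≠ 2) {ω n u v : ZMod p} (hn : IsSquare n) (hω : ¬ IsSquare ω)
    (h : (AdjoinRoot.of (X ^ 2 - C ω) u + AdjoinRoot.of (X ^ 2 - C ω) v * AdjoinRoot.root (X ^ 2 - C ω)) ^ 2 =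
      AdjoinRoot.of (X ^ 2 - C ω) n) : u ^ 2 = n := by
  set θ := AdjoinRoot.root (X ^ 2 - C ω : (ZMod p)[X])
  set ι := AdjoinRoot.of (X ^ 2 - C ω : (ZMod p)[X])
  have hexp : ι (u ^ 2 + v ^ 2 * ω - n) + ι (2 * u * v) * θ = 0 := by
    have hθ := root_sq ω
    rw [map_sub, map_add, map_mul, map_pow, map_pow, map_mul, map_mul, map_ofNat, sub_add_eq_add_sub, sub_eq_zero]
    rw [← h]
    linear_combination (-(ι v) ^ 2) * hθ
  obtain ⟨h1, h2⟩ := of_add_of_mul_root_eq_zero hexp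
  rcases eq_or_ne v 0 with hv | hv
  · rw [hv] at h1; simpa [sub_eq_zero] using h1
  · have hu : u = 0 := by
      rcases mul_eq_zero.1 h2 with h3 | h3
      · rcases mul_eq_zero.1 h3 with h4 | h4
        · exact absurd h4 (two_ne_zero_of_ne_two hp2)
        · exact h4
      · exact absurd h3 hv
    rw [hu] at h1
    have hωeq : ω = n * v⁻¹ ^ 2 := by
      field_simp
      linear_combination h1
    obtain ⟨s, hs⟩ := hn
    exact absurd ⟨s * v⁻¹, by rw [hωeq, hs]; ring⟩ hω

/-- The residue of `t² − n` computed on naturals: `ω = (t·t mod p + (p − n mod p)) mod p`. [folklore] -/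
theorem natCast_omega (n t : ℕ) :
    (((t * t % p + (p - n % p)) % p : ℕ) : ZMod p) = (t : ZMod p) ^ 2 - n := by
  have hnp : n % p ≤ p := (Nat.mod_lt n hp.out.pos).le
  rw [ZMod.natCast_mod, Nat.cast_add, ZMod.natCast_mod, Nat.cast_sub hnp, ZMod.natCast_self, ZMod.natCast_mod]
  push_cast; ring

/-- **Cipolla's algorithm is correct on the kernel `qpow`**: for an odd prime `p`, a residue `n` and a
trial `t` with `ω = t² − n` a NON-residue, the first coordinate `u` of
`qpow ω p (t, 1) ((p+1)/2)` is a square root of `n` modulo `p`. [cite: CrandallPomerance1999, §2.3.2 (Algorithm 2.3.8)] -/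
theorem sq_qpow_fst_eq (hp2 : p ≠ 2) {n t ω : ℕ} (hω : (ω : ZMod p) = (t : ZMod p) ^ 2 - n)
    (hn : IsSquare (n : ZMod p)) (hωs : ¬ IsSquare (ω : ZMod p)) :
    ((qpow ω p (t, 1) ((p + 1) / 2)).1 : ZMod p) ^ 2 = n := by
  set θ := AdjoinRoot.root (X ^ 2 - C (ω : ZMod p) : (ZMod p)[X])
  set ι := AdjoinRoot.of (X ^ 2 - C (ω : ZMod p) : (ZMod p)[X])
  have hθ : θ * θ = ((ω : ℕ) : CR (ω : ZMod p)) := by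
    rw [root_sq, ← map_natCast ι]
  have hω0 : (ω : ZMod p) ≠ 0 := fun h => hωs ⟨0, by rw [h, mul_zero]⟩
  have hωpow : (ω : ZMod p) ^ (p / 2) = -1 :=
    (ZMod.pow_div_two_eq_neg_one_or_one p hω0).resolve_left fun h1 => hωs ((ZMod.euler_criterion p hω0).2 h1)
  have hpow := φ_qpow θ ω p hθ (t, 1) ((p + 1) / 2)
  have hφt : φ θ (t, 1) = ι t + θ := by
    show ((t : ℕ) : CR (ω : ZMod p)) + ((1 : ℕ) : CR (ω : ZMod p)) * θ = ι t + θ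
    rw [map_natCast ι t, Nat.cast_one, one_mul]
  rw [hφt] at hpow
  set r := qpow ω p (t, 1) ((p + 1) / 2)
  have hr : (ι r.1 + ι r.2 * θ) ^ 2 = ι n := by
    have e1 : ι r.1 + ι r.2 * θ = φ θ r := by rw [map_natCast ι r.1, map_natCast ι r.2]; rfl
    rw [e1, hpow, cipolla_sq hp2 hωpow]
    congr 1
    rw [hω]; ring
  have h := sq_eq_of_coords hp2 hn hωs hr
  exact_mod_cast h

end Field

/-! ### At least half of the trials are good -/

section Count

open Finset

variable {p : ℕ} [hp : Fact p.Prime]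

/-- **The hyperbola `t² − s² = n` over `𝔽_p` has `p − 1` points** for `n ≠ 0`, `p` odd (the
factorisation `(t − s)(t + s) = n` parametrises it by the units). [folklore] -/
theorem card_hyperbola (hp2 : p ≠ 2) {n : ZMod p} (hn0 : n ≠ 0) :
    ((univ : Finset (ZMod p × ZMod p)).filter fun x => x.1 ^ 2 - x.2 ^ 2 = n).card = p - 1 := by
  have h2 : (2 : ZMod p) ≠ 0 := two_ne_zero_of_ne_two hp2
  have hcardU : (univ : Finset (ZMod p)ˣ).card = p - 1 := by
    rw [card_univ, ZMod.card_units_eq_totient, Nat.totient_prime hp.out]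
  rw [← hcardU]
  symm
  refine card_nbij' (fun u : (ZMod p)ˣ => (((u : ZMod p) + n * (u⁻¹ : (ZMod p)ˣ)) * 2⁻¹,
      ((u : ZMod p) - n * (u⁻¹ : (ZMod p)ˣ)) * 2⁻¹))
    (fun x => if h : x.1 + x.2 = 0 then 1 else Units.mk0 (x.1 + x.2) h) (fun u _ => ?_) (fun _ _ => mem_univ _)
    (fun u _ => ?_) (fun x hx => ?_)
  · rw [mem_coe, mem_filter]
    refine ⟨mem_univ _, ?_⟩
    have hu : ((u : ZMod p)) * ((u⁻¹ : (ZMod p)ˣ) : ZMod p) = 1 := u.mul_inv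
    field_simp
    linear_combination (4 * n) * hu
  · have hsum : ((u : ZMod p) + n * (u⁻¹ : (ZMod p)ˣ)) * 2⁻¹ + ((u : ZMod p) - n * (u⁻¹ : (ZMod p)ˣ)) * 2⁻¹ = u := by
      field_simp; ring
    have hne : (u : ZMod p) ≠ 0 := u.ne_zero
    dsimp only
    simp only [hsum, hne, dite_false]
    exact Units.ext rfl
  · rw [mem_coe, mem_filter] at hx
    obtain ⟨-, hx⟩ := hx
    have hne : x.1 + x.2 ≠ 0 := by
      intro h0
      have : x.1 ^ 2 - x.2 ^ 2 = (x.1 + x.2) * (x.1 - x.2) := by ring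
      rw [this, h0, zero_mul] at hx
      exact hn0 hx.symm
    dsimp only
    simp only [hne, dite_false]
    have hinv : ((Units.mk0 (x.1 + x.2) hne)⁻¹ : (ZMod p)ˣ) = ((x.1 + x.2)⁻¹ : ZMod p) := by simp
    rw [Units.val_mk0, hinv]
    have hdiff : n * (x.1 + x.2)⁻¹ = x.1 - x.2 := by
      rw [← hx]; field_simp; ring
    rw [hdiff]
    ext
    · field_simp; ring
    · field_simp; ring

/-- The number of `t` with `t² = n` is at most `2`. [folklore] -/
theorem card_filter_sq_eq_le (n : ZMod p) : ((univ : Finset (ZMod p)).filter fun t => t ^ 2 = n).card ≤ 2 := by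
  by_cases h : ∃ s : ZMod p, s ^ 2 = n
  · obtain ⟨s, hs⟩ := h
    calc ((univ : Finset (ZMod p)).filter fun t => t ^ 2 = n).card ≤ ({s, -s} : Finset (ZMod p)).card := by
          refine card_le_card fun t ht => ?_
          rw [mem_filter] at ht
          rw [mem_insert, mem_singleton]
          exact sq_eq_sq_iff_eq_or_eq_neg.1 (ht.2.trans hs.symm)
      _ ≤ 2 := card_insert_le _ _ |>.trans (by simp)
  · push Not at h
    rw [filter_eq_empty_iff.2 (fun t _ => h t), card_empty]
    exact Nat.zero_le _

/-- **At most `(p+1)/2` residues `t` have `t² − n` a square** (`n ≠ 0`, `p` odd): counting the points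
of the hyperbola by their first coordinate, each such `t` contributes `2` (or `1` for the at most two
`t` with `t² = n`). [cite: CrandallPomerance1999, §2.3.2] -/
theorem card_filter_isSquare_sq_sub_le (hp2 : p ≠ 2) {n : ZMod p} (hn0 : n ≠ 0) :
    2 * ((univ : Finset (ZMod p)).filter fun t => IsSquare (t ^ 2 - n)).card ≤ p + 1 := by
  classical
  set T := (univ : Finset (ZMod p)).filter fun t => IsSquare (t ^ 2 - n)
  set Z := (univ : Finset (ZMod p)).filter fun t => t ^ 2 = n
  set fib : ZMod p → Finset (ZMod p) := fun t => univ.filter fun s => t ^ 2 - s ^ 2 = n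
  -- the hyperbola fibrewise
  have hP : ((univ : Finset (ZMod p × ZMod p)).filter fun x => x.1 ^ 2 - x.2 ^ 2 = n).card =
      ∑ t : ZMod p, (fib t).card := by
    rw [card_filter, ← univ_product_univ, sum_product]
    refine sum_congr rfl fun t _ => ?_
    rw [card_filter]
  -- each `t ∈ T` has a fibre of size `≥ 2`, or `≥ 1` if `t ∈ Z`
  have hfib : ∀ t ∈ T, 2 ≤ (fib t).card + (if t ^ 2 = n then 1 else 0) := by
    intro t ht
    rw [mem_filter] at ht
    obtain ⟨s, hs⟩ := ht.2
    have hsmem : s ∈ fib t := by rw [mem_filter]; exact ⟨mem_univ _, by linear_combination hs⟩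
    by_cases htn : t ^ 2 = n
    · rw [if_pos htn]
      have : 1 ≤ (fib t).card := card_pos.2 ⟨s, hsmem⟩
      omega
    · rw [if_neg htn, add_zero]
      have hs0 : s ≠ 0 := by
        rintro rfl
        rw [mul_zero, sub_eq_zero] at hs
        exact htn hs
      have hneg : -s ∈ fib t := by rw [mem_filter]; exact ⟨mem_univ _, by linear_combination hs⟩
      have hne : s ≠ -s := fun h => hs0 (by
        have : (2 : ZMod p) * s = 0 := by linear_combination h
        exact (mul_eq_zero.1 this).resolve_left (two_ne_zero_of_ne_two hp2))
      calc 2 = ({s, -s} : Finset (ZMod p)).card := by rw [card_pair hne]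
        _ ≤ (fib t).card := card_le_card fun x hx => by
            rw [mem_insert, mem_singleton] at hx
            rcases hx with rfl | rfl <;> assumption
  have hsum : 2 * T.card ≤ ∑ t ∈ T, ((fib t).card + (if t ^ 2 = n then 1 else 0)) := by
    rw [mul_comm, ← smul_eq_mul, ← sum_const]
    exact sum_le_sum hfib
  rw [sum_add_distrib, ← card_filter] at hsum
  have hZ : (T.filter fun t => t ^ 2 = n).card ≤ 2 :=
    (card_le_card (by intro t ht; rw [mem_filter] at ht ⊢; exact ⟨mem_univ _, ht.2⟩)).trans (card_filter_sq_eq_le n)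
  have hT : ∑ t ∈ T, (fib t).card ≤ ∑ t : ZMod p, (fib t).card :=
    sum_le_sum_of_subset_of_nonneg (subset_univ T) fun _ _ _ => Nat.zero_le _
  rw [← hP, card_hyperbola hp2 hn0] at hT
  have hp1 : 1 ≤ p := hp.out.pos
  omega

/-- **At least `(p−1)/2` trials are good**: `p − 1 ≤ 2 · #{t : t² − n is a non-residue}`.
[cite: CrandallPomerance1999, §2.3.2] -/
theorem le_card_filter_not_isSquare (hp2 : p ≠ 2) {n : ZMod p} (hn0 : n ≠ 0) :
    p - 1 ≤ 2 * ((univ : Finset (ZMod p)).filter fun t => ¬ IsSquare (t ^ 2 - n)).card := by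
  classical
  have h := card_filter_isSquare_sq_sub_le hp2 hn0
  have hsum := card_filter_add_card_filter_not (s := (univ : Finset (ZMod p)))
    (p := fun t => IsSquare (t ^ 2 - n))
  rw [card_univ, ZMod.card] at hsum
  omega

end Count

end Cipolla

end Literature.Computability.Cryptography.Hallgren2005
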